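import Summits.AtomisticToContinuum.FouriersLaw.Theorems.BondHeatUncertaintyExtensiveSnapshotIrreversibilityEnergyWindowTree
import Summits.AtomisticToContinuum.FouriersLaw.Theses.BondHeatUncertainty
import Summits.AtomisticToContinuum.FouriersLaw.Theorems.ExtensiveSnapshotIrreversibility.Negative.TiltedCriterion
import Summits.AtomisticToContinuum.FouriersLaw.Theorems.BondHeatUncertaintyExtensiveSnapshotIrreversibilityOddLogDensityOfRegularity

/-!
# Crux `ExtensiveSnapshotIrreversibility` (stmt-AtomisticToContinuum-9121), fixed-`N` half `K_fix`
(`SnapshotKLUpperExpansion` = the conclusion of `ClausiusBudget.stub_snapshotKLUpper_of_density`):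
the ENERGY-WINDOW reduction

(helper file, theorem-side; grading of phase space by the energy level `H ≤ E`, with the
`δ`-adaptive window `e^{(θ/6)H} ≤ 1/|δ|`, i.e. `E_δ = (6/θ) log(1/|δ|)`.)

Part 2/4 of the energy-window reduction (imports `…EnergyWindowTree`: tree lemmas + toolkit).

Setting. `μ₀` a flip-invariant probability measure on phase space (`Θ(q,p) = (q,−p)`), `W ≥ 0` a
flip-invariant measurable weight (for the chain: `μ₀ = μ_T` the Gibbs state, `W = H`), and a family of
states `μ_δ = μ₀ · e^{φ_δ}` (`∫ e^{φ_δ} dμ₀ = 1`).  With `f := e^{φ}`, `d := φ − φ∘Θ` one has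
`KL(μ_δ ‖ Θ_*μ_δ) = ∫ d f dμ₀` (`Tree.toReal_klDiv_flip_tilted`).  Split at the window
`S_δ := {e^{(θ/6)W} ≤ 1/|δ|}` (flip-invariant):

* TAIL `∫_{S_δᶜ} d f dμ₀ ≤ C₂ M C₁ |δ|³` from ONLY (T1) a uniform exponential moment
  `∫ e^{θW} dμ_δ ≤ C₁` and (T2o) a CRUDE, `δ`-UNIFORM polynomial bound on the odd log-density
  `|φ_δ − φ_δ∘Θ| ≤ C₂ (1 + W)^k` (no `O(δ)` precision: on the complement of the window
  `(1 + W)^k ≤ M e^{θW/2} ≤ M |δ|³ e^{θW}`);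
* BULK `∫_{S_δ} d f dμ₀ = ½ ∫_{S_δ} d (f − f∘Θ) dμ₀ ≤ ½ (1 − η_δ)⁻¹ ∫ (f − f∘Θ)² dμ₀` from (B1w) the
  one-sided WINDOW LOWER BOUND `f_δ ≥ 1 − C₃|δ|(1 + W)^m e^{aW}` (`12a < θ`; on the window this is
  `≥ 1 − η_δ`, `η_δ = C₃ M' √|δ| → 0`) and the pointwise inequality
  `(a − b)(e^a − e^b) ≤ (e^a − e^b)²/L` for `e^a, e^b ≥ L > 0`;
* SHARPNESS from (B2) `limsup δ⁻² ∫ (f_δ − f_δ∘Θ)² dμ₀ ≤ D`, i.e. the quadratic-mean (strong `L²(μ₀)`)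
  differentiability of the odd part of the DENSITY RATIO `f_δ = dμ_δ/dμ₀` at `δ = 0` (no logarithm).

Conclusion: `KL(μ_δ ‖ Θ_*μ_δ) ≤ K δ²` eventually, for every `K > D/2` — the abstract seam
`klDiv_flip_le_of_energyWindow` (this file: one state with explicit constants,
`klDiv_flip_tilted_le_window`, then the filter form).  The companion file `…EnergyWindowChain`
specialises it to the pinned chain: `K_fix` VERBATIM follows from the statement `(W)` = (W0)
`μ_{N,T+δ/2,T−δ/2} = μ_T · e^{φ_δ}` ∧ (T1) ∧ (T2o) ∧ (B1w) ∧ (B2: an `L²(μ_T)` function `g₀` with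
`∫ ((e^{φ_δ} − 1)/δ − g₀)² dμ_T → 0`) — theorem `snapshotKLUpperExpansion_of_energyWindow` there; the
response density `h` of the item's interface is identified with `g₀` a.e.
(`Tree.ae_eq_of_tendsto_testFunction`), so the constant is the item's `½ ∫ (h − h∘Θ)² dμ_{N,T,T}`.

Dictionary to the atoms of record (proved in the companion file): the regularity statement (R) of
`ClausiusBudget.stub_oddLogDensity_of_regularity` (S1g: (R2) `|φ_δ| ≤ η(1+H)`, `η < 1/(4T)`,
(R3) `|φ_δ| ≤ C|δ|(1+H)^k`, (R4) `φ_δ/δ → h₀` pointwise) implies EACH atom of (W):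
(R2) ⇒ (T1) with `θ = (1/T − η)/2` and (T2o) with `k = 1`; (R3) ⇒ (B1w) with `a = 0` (`1 + u ≤ e^u`);
(R2)+(R3)+(R4) ⇒ (B2) with `g₀ = h₀` (dominated convergence in `L²(μ_T)`, domination
`C²(1+H)^{2k} e^{2η(1+H)} ∈ L¹(μ_T)` as `2η < 1/T`).  Hence `K_fix ⟸ (W) ⟸ (R)`: the window statement
sits between the item and the regularity atoms of record, and what it DROPS is visible — the
`O(δ)`-precision two-sided control of `log ρ_δ − log ρ_T` at ALL energies ((R3), and the Gibbs-type
density sandwich of the `hellinger-logmean` line) is replaced by the `δ`-uniform crude odd bound (T2o)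
plus a one-sided polynomial lower bound, because the Lyapunov tail beyond `E_δ` has mass `O(|δ|³)`.

No new objects: this file is pure measure theory over `PhaseSpace N`; the companion file's only
definitions are the `Prop` abbreviations of the statement texts (W), (R), `K_fix` (the latter two

No new objects: this file is pure measure theory over `PhaseSpace N`; the companion files' only
definitions are the `Prop` abbreviations of the statement texts (W), (R), `K_fix` (the latter two
token-for-token the tree texts).  References: see `…EnergyWindowTree`.
-/

noncomputable section

namespace Summit.AtomisticToContinuum.FouriersLaw.Theorems.ExtensiveSnapshotIrreversibility.EnergyWindow

open MeasureTheory Filter Topology InformationTheory Real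
open scoped ENNReal NNReal
open Literature.MathematicalPhysics.KineticTheory.HeatConduction
-- `open Tree` replaced at landing (reviewer of p847350): the flip/tilt/test-function lemmas are the tree originals
open Summit.AtomisticToContinuum.FouriersLaw.Theorems.ExtensiveSnapshotIrreversibility.Negative
open Summit.AtomisticToContinuum.FouriersLaw.Theorems.ExtensiveSnapshotIrreversibility.ClausiusBudget.OddLogDensity

variable {N : ℕ}

/-! ## 2. The abstract energy-window seam (one state, explicit constants) -/

section Seam

variable (μ₀ : Measure (PhaseSpace N)) [IsProbabilityMeasure μ₀]

/-- **Energy-window bound for one tilted state (explicit constants).** `μ₀` a flip-invariant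
probability measure, `W ≥ 0` a flip-invariant measurable weight, `μ = μ₀ · e^{φ}` (`∫ e^φ dμ₀ = 1`).
Assume, with `u > 0` (think `u = √|δ|`): the exponential moment `∫ e^{θW} e^{φ} dμ₀ ≤ C₁`, the crude
odd bound `|φ − φ∘Θ| ≤ C₂(1 + W)^k`, the window lower bound `e^{φ} ≥ 1 − C₃u²(1 + W)^m e^{aW}`
(`12a < θ`, `C₃ ≥ 0`), `∫ (e^φ − e^{φ∘Θ})² dμ₀ ≤ D`, and the smallness
`η := C₃ M' u ≤ 1/2` (`M' = m! e^{s}/s^m`, `s = θ/12 − a`).  Then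
`KL(μ ‖ Θ_*μ) ≤ ½(1 + 2η) D + C₂ M C₁ u⁶` with `M = k! e^{θ/2}/(θ/2)^k` — the window is
`{e^{(θ/6)W} ≤ 1/u²}`; see the module docstring for the two-line proof. [folklore] -/
theorem klDiv_flip_tilted_le_window
    (hinv : μ₀.map (fun x : PhaseSpace N => (x.1, -x.2)) = μ₀)
    {W : PhaseSpace N → ℝ} (hWm : Measurable W) (hW0 : ∀ x, 0 ≤ W x)
    (hWflip : ∀ x : PhaseSpace N, W (x.1, -x.2) = W x)
    {φ : PhaseSpace N → ℝ} (hφm : Measurable φ)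
    (hZ : Integrable (fun x => exp (φ x)) μ₀) (hZ1 : ∫ x, exp (φ x) ∂μ₀ = 1)
    {θ a C₁ C₂ C₃ u D : ℝ} {k m : ℕ} (hθ : 0 < θ) (ha : 12 * a < θ) (hu : 0 < u) (hC₃ : 0 ≤ C₃)
    (hT1i : Integrable (fun x => exp (θ * W x) * exp (φ x)) μ₀)
    (hT1 : ∫ x, exp (θ * W x) * exp (φ x) ∂μ₀ ≤ C₁)
    (hT2 : ∀ x : PhaseSpace N, |φ x - φ (x.1, -x.2)| ≤ C₂ * (1 + W x) ^ k)
    (hB1 : ∀ x : PhaseSpace N, 1 - C₃ * u ^ 2 * (1 + W x) ^ m * exp (a * W x) ≤ exp (φ x))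
    (hB2i : Integrable (fun x => (exp (φ x) - exp (φ (x.1, -x.2))) ^ 2) μ₀)
    (hB2 : ∫ x, (exp (φ x) - exp (φ (x.1, -x.2))) ^ 2 ∂μ₀ ≤ D)
    (hη : C₃ * (m.factorial * exp (θ / 12 - a) / (θ / 12 - a) ^ m) * u ≤ 1 / 2) :
    klDiv (μ₀.tilted φ) ((μ₀.tilted φ).map (fun x : PhaseSpace N => (x.1, -x.2))) ≤
      ENNReal.ofReal ((1 / 2) * (1 + 2 * (C₃ * (m.factorial * exp (θ / 12 - a) / (θ / 12 - a) ^ m) * u))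
          * D + C₂ * (k.factorial * exp (θ / 2) / (θ / 2) ^ k) * C₁ * u ^ 6) := by
  -- constants
  set κ : ℝ := θ / 6 with hκ
  set s : ℝ := θ / 12 - a with hs
  have hspos : 0 < s := by rw [hs]; linarith
  set M' : ℝ := m.factorial * exp s / s ^ m with hM'
  set M : ℝ := k.factorial * exp (θ / 2) / (θ / 2) ^ k with hM
  have hM'pos : 0 < M' := by rw [hM']; positivity
  have hMpos : 0 < M := by rw [hM]; positivity
  set η : ℝ := C₃ * M' * u with hηdef
  have hη0 : 0 ≤ η := by rw [hηdef]; positivity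
  have hη2 : η ≤ 1 / 2 := hη
  have hC₂ : 0 ≤ C₂ := by
    have hp : 0 < (1 + W 0) ^ k := by have := hW0 0; positivity
    exact le_of_mul_le_mul_right (by rw [zero_mul]; exact (abs_nonneg _).trans (hT2 0)) hp
  have hD : 0 ≤ D := (integral_nonneg fun x => sq_nonneg _).trans hB2
  -- the odd log-density and the density
  set d : PhaseSpace N → ℝ := fun x => φ x - φ (x.1, -x.2) with hd
  have hΘm : Measurable (fun x : PhaseSpace N => (x.1, -x.2)) := (momentumReversal N).measurable
  have hdm : Measurable d := hφm.sub (hφm.comp hΘm)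
  have hdodd : ∀ x : PhaseSpace N, d (x.1, -x.2) = -d x := fun x => by simp [hd]
  have hem : Measurable fun x => exp (φ x) := hφm.exp
  have heΘm : Measurable fun x : PhaseSpace N => exp (φ (x.1, -x.2)) := (hφm.comp hΘm).exp
  -- the window
  set S : Set (PhaseSpace N) := {x | exp (κ * W x) ≤ 1 / u ^ 2} with hSdef
  have hS : MeasurableSet S := measurableSet_le (hWm.const_mul κ).exp measurable_const
  have hSflip : ∀ x : PhaseSpace N, (x.1, -x.2) ∈ S ↔ x ∈ S := fun x => by
    simp only [hSdef, Set.mem_setOf_eq, hWflip]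
  -- integrability
  have hpolθ : ∀ x, (1 + W x) ^ k ≤ (k.factorial * exp θ / θ ^ k) * exp (θ * W x) := fun x =>
    one_add_pow_le_factorial_mul_exp k (hW0 x) hθ
  have I1 : Integrable (fun x => (1 + W x) ^ k * exp (φ x)) μ₀ := by
    refine (hT1i.const_mul (k.factorial * exp θ / θ ^ k)).mono'
      (((measurable_const.add hWm).pow_const k).mul hem).aestronglyMeasurable
      (ae_of_all _ fun x => ?_)
    rw [Real.norm_eq_abs, abs_of_nonneg (by have := hW0 x; positivity)]
    calc (1 + W x) ^ k * exp (φ x) ≤ (k.factorial * exp θ / θ ^ k) * exp (θ * W x) * exp (φ x) :=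
          mul_le_mul_of_nonneg_right (hpolθ x) (exp_pos _).le
      _ = (k.factorial * exp θ / θ ^ k) * (exp (θ * W x) * exp (φ x)) := by ring
  have I1Θ : Integrable (fun x : PhaseSpace N => (1 + W x) ^ k * exp (φ (x.1, -x.2))) μ₀ := by
    have h := (integrable_comp_flip_iff μ₀ hinv (fun x => (1 + W x) ^ k * exp (φ x))).2 I1
    refine h.congr (ae_of_all _ fun x => ?_)
    simp only [hWflip]
  have I_d : Integrable (fun x => exp (φ x) * d x) μ₀ := by
    refine (I1.const_mul C₂).mono' (hem.mul hdm).aestronglyMeasurable (ae_of_all _ fun x => ?_)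
    rw [Real.norm_eq_abs, abs_mul, abs_of_pos (exp_pos _)]
    calc exp (φ x) * |d x| ≤ exp (φ x) * (C₂ * (1 + W x) ^ k) :=
          mul_le_mul_of_nonneg_left (hT2 x) (exp_pos _).le
      _ = C₂ * ((1 + W x) ^ k * exp (φ x)) := by ring
  have I_dΘ : Integrable (fun x : PhaseSpace N => exp (φ (x.1, -x.2)) * d x) μ₀ := by
    refine (I1Θ.const_mul C₂).mono' (heΘm.mul hdm).aestronglyMeasurable (ae_of_all _ fun x => ?_)
    rw [Real.norm_eq_abs, abs_mul, abs_of_pos (exp_pos _)]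
    calc exp (φ (x.1, -x.2)) * |d x| ≤ exp (φ (x.1, -x.2)) * (C₂ * (1 + W x) ^ k) :=
          mul_le_mul_of_nonneg_left (hT2 x) (exp_pos _).le
      _ = C₂ * ((1 + W x) ^ k * exp (φ (x.1, -x.2))) := by ring
  -- the value of the divergence as a `μ₀`-integral, and its finiteness
  have hdt : Integrable d (μ₀.tilted φ) := by
    rw [integrable_tilted_iff hZ d]
    refine I_d.congr (ae_of_all _ fun x => ?_)
    simp only [smul_eq_mul]
  have hfin : klDiv (μ₀.tilted φ) ((μ₀.tilted φ).map (fun x : PhaseSpace N => (x.1, -x.2))) ≠ ∞ :=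
    (klDiv_flip_tilted_ne_top_iff hinv hφm hZ).2 hdt
  have hval : (klDiv (μ₀.tilted φ) ((μ₀.tilted φ).map (fun x : PhaseSpace N => (x.1, -x.2)))).toReal
      = ∫ x, exp (φ x) * d x ∂μ₀ := by
    rw [toReal_klDiv_flip_tilted hinv hφm hZ, integral_tilted]
    refine integral_congr_ae (ae_of_all _ fun x => ?_)
    simp only [hZ1, div_one, smul_eq_mul, hd]
  -- split at the window
  have hsplit : ∫ x, exp (φ x) * d x ∂μ₀ =
      ∫ x in S, exp (φ x) * d x ∂μ₀ + ∫ x in Sᶜ, exp (φ x) * d x ∂μ₀ :=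
    (integral_add_compl hS I_d).symm
  -- BULK: symmetrisation on the (flip-invariant) window
  have hinvS : (μ₀.restrict S).map (fun x : PhaseSpace N => (x.1, -x.2)) = μ₀.restrict S := by
    have hpre : (fun x : PhaseSpace N => (x.1, -x.2)) ⁻¹' S = S := by
      ext x; simp only [Set.mem_preimage]; exact hSflip x
    have hme : MeasurableEmbedding (fun x : PhaseSpace N => (x.1, -x.2)) :=
      (momentumReversal N).measurableEmbedding
    calc (μ₀.restrict S).map (fun x : PhaseSpace N => (x.1, -x.2))
        = (μ₀.restrict ((fun x : PhaseSpace N => (x.1, -x.2)) ⁻¹' S)).map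
            (fun x : PhaseSpace N => (x.1, -x.2)) := by rw [hpre]
      _ = (μ₀.map (fun x : PhaseSpace N => (x.1, -x.2))).restrict S := (hme.restrict_map μ₀ S).symm
      _ = μ₀.restrict S := by rw [hinv]
  have e1 : ∫ x in S, exp (φ (x.1, -x.2)) * d x ∂μ₀ = -∫ x in S, exp (φ x) * d x ∂μ₀ := by
    have h : ∫ x in S, exp (φ (x.1, -x.2)) * d (x.1, -x.2) ∂μ₀ = ∫ x in S, exp (φ x) * d x ∂μ₀ :=
      integral_comp_flip (μ₀.restrict S) hinvS (fun x => exp (φ x) * d x)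
    calc ∫ x in S, exp (φ (x.1, -x.2)) * d x ∂μ₀
        = ∫ x in S, -(exp (φ (x.1, -x.2)) * d (x.1, -x.2)) ∂μ₀ := by
          refine integral_congr_ae (ae_of_all _ fun x => ?_)
          show exp (φ (x.1, -x.2)) * d x = -(exp (φ (x.1, -x.2)) * d (x.1, -x.2))
          rw [hdodd x]
          ring
      _ = -∫ x in S, exp (φ (x.1, -x.2)) * d (x.1, -x.2) ∂μ₀ := integral_neg _
      _ = -∫ x in S, exp (φ x) * d x ∂μ₀ := by rw [h]
  have I_bulk : Integrable (fun x : PhaseSpace N => d x * (exp (φ x) - exp (φ (x.1, -x.2)))) μ₀ := by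
    refine (I_d.sub I_dΘ).congr (ae_of_all _ fun x => ?_)
    simp only [Pi.sub_apply]
    ring
  have e2 : ∫ x in S, exp (φ x) * d x ∂μ₀ =
      (1 / 2) * ∫ x in S, d x * (exp (φ x) - exp (φ (x.1, -x.2))) ∂μ₀ := by
    have h : ∫ x in S, d x * (exp (φ x) - exp (φ (x.1, -x.2))) ∂μ₀ =
        ∫ x in S, exp (φ x) * d x ∂μ₀ - ∫ x in S, exp (φ (x.1, -x.2)) * d x ∂μ₀ := by
      rw [← integral_sub I_d.integrableOn I_dΘ.integrableOn]
      refine integral_congr_ae (ae_of_all _ fun x => ?_)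
      ring
    rw [h, e1]
    ring
  -- on the window both densities are `≥ 1 − η`
  have hlow : ∀ x ∈ S, 1 - η ≤ exp (φ x) := by
    intro x hx
    have hx' : exp (κ * W x) ≤ 1 / u ^ 2 := hx
    have hhalf : exp (κ / 2 * W x) ≤ 1 / u := exp_half_mul_le_of_window hu hx'
    have hpol : (1 + W x) ^ m ≤ M' * exp (s * W x) := one_add_pow_le_factorial_mul_exp m (hW0 x) hspos
    have hprod : (1 + W x) ^ m * exp (a * W x) ≤ M' * (1 / u) := by
      calc (1 + W x) ^ m * exp (a * W x) ≤ M' * exp (s * W x) * exp (a * W x) :=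
            mul_le_mul_of_nonneg_right hpol (exp_pos _).le
        _ = M' * exp (κ / 2 * W x) := by
            rw [mul_assoc, ← exp_add]
            congr 2
            rw [hs, hκ]
            ring
        _ ≤ M' * (1 / u) := mul_le_mul_of_nonneg_left hhalf hM'pos.le
    have hkey : C₃ * u ^ 2 * (1 + W x) ^ m * exp (a * W x) ≤ η := by
      calc C₃ * u ^ 2 * (1 + W x) ^ m * exp (a * W x)
          = C₃ * u ^ 2 * ((1 + W x) ^ m * exp (a * W x)) := by ring
        _ ≤ C₃ * u ^ 2 * (M' * (1 / u)) := mul_le_mul_of_nonneg_left hprod (by positivity)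
        _ = η := by rw [hηdef]; field_simp
    linarith [hB1 x]
  have e3 : ∀ x ∈ S, d x * (exp (φ x) - exp (φ (x.1, -x.2))) ≤
      (exp (φ x) - exp (φ (x.1, -x.2))) ^ 2 / (1 - η) := by
    intro x hx
    exact sub_mul_exp_sub_exp_le_sq_div (by linarith) (hlow x hx) (hlow _ ((hSflip x).2 hx))
  have e4 : ∫ x in S, d x * (exp (φ x) - exp (φ (x.1, -x.2))) ∂μ₀ ≤
      ∫ x in S, (exp (φ x) - exp (φ (x.1, -x.2))) ^ 2 / (1 - η) ∂μ₀ :=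
    setIntegral_mono_on I_bulk.integrableOn (hB2i.div_const _).integrableOn hS e3
  have e5 : ∫ x in S, (exp (φ x) - exp (φ (x.1, -x.2))) ^ 2 / (1 - η) ∂μ₀ ≤ D / (1 - η) := by
    rw [integral_div]
    exact div_le_div_of_nonneg_right
      ((setIntegral_le_integral hB2i (ae_of_all _ fun x => sq_nonneg _)).trans hB2) (by linarith)
  have hbulk : ∫ x in S, exp (φ x) * d x ∂μ₀ ≤ (1 / 2) * (1 + 2 * η) * D := by
    rw [e2]
    have h1 : D / (1 - η) ≤ (1 + 2 * η) * D := by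
      rw [div_eq_mul_one_div, mul_comm]
      exact mul_le_mul_of_nonneg_right (one_div_one_sub_le hη0 hη2) hD
    nlinarith [e4, e5, h1]
  -- TAIL: on the complement `(1 + W)^k ≤ M u⁶ e^{θ W}`
  have htailpt : ∀ x ∈ Sᶜ, exp (φ x) * d x ≤ C₂ * M * u ^ 6 * (exp (θ * W x) * exp (φ x)) := by
    intro x hx
    have hx' : 1 / u ^ 2 < exp (κ * W x) := lt_of_not_ge hx
    have hwin := exp_three_mul_le_of_window (by positivity : 0 < u ^ 2) hx'
    have h3 : exp (θ / 2 * W x) ≤ u ^ 6 * exp (θ * W x) := by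
      have e6 : (u ^ 2) ^ 3 = u ^ 6 := by ring
      calc exp (θ / 2 * W x) = exp (3 * κ * W x) := by rw [hκ]; ring_nf
        _ ≤ (u ^ 2) ^ 3 * exp (6 * κ * W x) := hwin
        _ = u ^ 6 * exp (θ * W x) := by rw [e6, hκ]; ring_nf
    have hpol : (1 + W x) ^ k ≤ M * exp (θ / 2 * W x) :=
      one_add_pow_le_factorial_mul_exp k (hW0 x) (by positivity)
    have hdle : d x ≤ C₂ * (1 + W x) ^ k := (le_abs_self _).trans (hT2 x)
    calc exp (φ x) * d x ≤ exp (φ x) * (C₂ * (1 + W x) ^ k) :=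
          mul_le_mul_of_nonneg_left hdle (exp_pos _).le
      _ ≤ exp (φ x) * (C₂ * (M * (u ^ 6 * exp (θ * W x)))) := by
          refine mul_le_mul_of_nonneg_left (mul_le_mul_of_nonneg_left ?_ hC₂) (exp_pos _).le
          exact hpol.trans (mul_le_mul_of_nonneg_left h3 hMpos.le)
      _ = C₂ * M * u ^ 6 * (exp (θ * W x) * exp (φ x)) := by ring
  have htail : ∫ x in Sᶜ, exp (φ x) * d x ∂μ₀ ≤ C₂ * M * C₁ * u ^ 6 := by
    have t1 : ∫ x in Sᶜ, exp (φ x) * d x ∂μ₀ ≤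
        ∫ x in Sᶜ, C₂ * M * u ^ 6 * (exp (θ * W x) * exp (φ x)) ∂μ₀ :=
      setIntegral_mono_on I_d.integrableOn (hT1i.const_mul _).integrableOn hS.compl htailpt
    have t2 : ∫ x in Sᶜ, C₂ * M * u ^ 6 * (exp (θ * W x) * exp (φ x)) ∂μ₀ =
        C₂ * M * u ^ 6 * ∫ x in Sᶜ, exp (θ * W x) * exp (φ x) ∂μ₀ := integral_const_mul _ _
    have t3 : ∫ x in Sᶜ, exp (θ * W x) * exp (φ x) ∂μ₀ ≤ C₁ :=
      (setIntegral_le_integral hT1i (ae_of_all _ fun x => by positivity)).trans hT1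
    have hc : 0 ≤ C₂ * M * u ^ 6 := by positivity
    calc ∫ x in Sᶜ, exp (φ x) * d x ∂μ₀ ≤ C₂ * M * u ^ 6 * ∫ x in Sᶜ, exp (θ * W x) * exp (φ x) ∂μ₀ :=
          t1.trans (le_of_eq t2)
      _ ≤ C₂ * M * u ^ 6 * C₁ := mul_le_mul_of_nonneg_left t3 hc
      _ = C₂ * M * C₁ * u ^ 6 := by ring
  -- conclusion
  rw [← ENNReal.ofReal_toReal hfin, hval, hsplit]
  exact ENNReal.ofReal_le_ofReal (by linarith [hbulk, htail])

/-! ## 3. The seam along a family: `KL(μ_δ ‖ Θ_*μ_δ) ≤ K δ²` eventually, for every `K > D/2` -/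

/-- **Abstract energy-window seam (filter form).** For a family of tilts `μ_δ = μ₀ · e^{φ_δ}`
(`∫ e^{φ_δ} dμ₀ = 1` eventually in `δ ≠ 0`) of a flip-invariant probability measure `μ₀` with a
flip-invariant weight `W ≥ 0`: (T1) `∫ e^{θW} dμ_δ ≤ C₁`, (T2o) `|φ_δ − φ_δ∘Θ| ≤ C₂(1 + W)^k`,
(B1w) `e^{φ_δ} ≥ 1 − C₃|δ|(1 + W)^m e^{aW}` (`12a < θ`), all eventually, and
(B2) `∫ (e^{φ_δ} − e^{φ_δ∘Θ})² dμ₀ ≤ D' δ²` eventually for every `D' > D`, imply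
`KL(μ_δ ‖ Θ_*μ_δ) ≤ K δ²` eventually for every `K > D/2` (window `e^{(θ/6)W} ≤ 1/|δ|`,
`klDiv_flip_tilted_le_window` with `u = √|δ|`: bulk `½(1 + O(√|δ|)) D' δ²`, tail `O(|δ|³)`).
[folklore] -/
theorem klDiv_flip_le_of_energyWindow
    (hinv : μ₀.map (fun x : PhaseSpace N => (x.1, -x.2)) = μ₀)
    {W : PhaseSpace N → ℝ} (hWm : Measurable W) (hW0 : ∀ x, 0 ≤ W x)
    (hWflip : ∀ x : PhaseSpace N, W (x.1, -x.2) = W x)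
    {θ a C₁ C₂ C₃ D : ℝ} {k m : ℕ} (hθ : 0 < θ) (ha : 12 * a < θ)
    (φ : ℝ → PhaseSpace N → ℝ) (hφm : ∀ δ, Measurable (φ δ))
    (hZ : ∀ᶠ δ in 𝓝[≠] (0 : ℝ), Integrable (fun x => exp (φ δ x)) μ₀ ∧ ∫ x, exp (φ δ x) ∂μ₀ = 1)
    (hT1 : ∀ᶠ δ in 𝓝[≠] (0 : ℝ), Integrable (fun x => exp (θ * W x) * exp (φ δ x)) μ₀ ∧
      ∫ x, exp (θ * W x) * exp (φ δ x) ∂μ₀ ≤ C₁)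
    (hT2 : ∀ᶠ δ in 𝓝[≠] (0 : ℝ), ∀ x : PhaseSpace N, |φ δ x - φ δ (x.1, -x.2)| ≤ C₂ * (1 + W x) ^ k)
    (hB1 : ∀ᶠ δ in 𝓝[≠] (0 : ℝ), ∀ x : PhaseSpace N,
      1 - C₃ * |δ| * (1 + W x) ^ m * exp (a * W x) ≤ exp (φ δ x))
    (hB2 : ∀ D' : ℝ, D < D' → ∀ᶠ δ in 𝓝[≠] (0 : ℝ),
      Integrable (fun x => (exp (φ δ x) - exp (φ δ (x.1, -x.2))) ^ 2) μ₀ ∧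
      ∫ x, (exp (φ δ x) - exp (φ δ (x.1, -x.2))) ^ 2 ∂μ₀ ≤ D' * δ ^ 2) :
    ∀ K : ℝ, D / 2 < K → ∀ᶠ δ in 𝓝[≠] (0 : ℝ),
      klDiv (μ₀.tilted (φ δ)) ((μ₀.tilted (φ δ)).map (fun x : PhaseSpace N => (x.1, -x.2))) ≤
        ENNReal.ofReal (K * δ ^ 2) := by
  intro K hK
  set D' : ℝ := K + D / 2 with hD'
  have hDD' : D < D' := by rw [hD']; linarith
  have hgap : 0 < K - D' / 2 := by rw [hD']; linarith
  set C₃' : ℝ := max C₃ 0 with hC₃'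
  have hC₃' : 0 ≤ C₃' := le_max_right _ _
  have hC₃le : C₃ ≤ C₃' := le_max_left _ _
  set M' : ℝ := m.factorial * exp (θ / 12 - a) / (θ / 12 - a) ^ m with hM'
  set M : ℝ := k.factorial * exp (θ / 2) / (θ / 2) ^ k with hM
  -- smallness events
  have t_abs : Tendsto (fun δ : ℝ => |δ|) (𝓝[≠] (0 : ℝ)) (𝓝 0) := by
    have h := (continuous_abs.tendsto (0 : ℝ))
    rw [abs_zero] at h
    exact h.mono_left nhdsWithin_le_nhds
  have t_sqrt : Tendsto (fun δ : ℝ => Real.sqrt |δ|) (𝓝[≠] (0 : ℝ)) (𝓝 0) := by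
    have h := (Real.continuous_sqrt.tendsto (0 : ℝ)).comp t_abs
    rw [Real.sqrt_zero] at h
    exact h
  have ev1 : ∀ᶠ δ in 𝓝[≠] (0 : ℝ), C₃' * M' * Real.sqrt |δ| < 1 / 2 := by
    have h := t_sqrt.const_mul (C₃' * M')
    rw [mul_zero] at h
    exact h.eventually_lt_const (by norm_num)
  have ev2 : ∀ᶠ δ in 𝓝[≠] (0 : ℝ), C₃' * M' * Real.sqrt |δ| * D' < (K - D' / 2) / 2 := by
    have h := (t_sqrt.const_mul (C₃' * M')).mul_const D'
    rw [mul_zero, zero_mul] at h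
    exact h.eventually_lt_const (by linarith)
  have ev3 : ∀ᶠ δ in 𝓝[≠] (0 : ℝ), C₂ * M * C₁ * |δ| < (K - D' / 2) / 2 := by
    have h := t_abs.const_mul (C₂ * M * C₁)
    rw [mul_zero] at h
    exact h.eventually_lt_const (by linarith)
  filter_upwards [hZ, hT1, hT2, hB1, hB2 D' hDD', ev1, ev2, ev3, self_mem_nhdsWithin] with δ hZδ hT1δ
    hT2δ hB1δ hB2δ h1 h2 h3 hδ
  have hδ0 : 0 < |δ| := abs_pos.2 hδ
  set u : ℝ := Real.sqrt |δ| with hu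
  have hupos : 0 < u := Real.sqrt_pos.2 hδ0
  have hu2 : u ^ 2 = |δ| := Real.sq_sqrt hδ0.le
  have hu6 : u ^ 6 = |δ| * δ ^ 2 := by
    have e : u ^ 6 = (u ^ 2) ^ 3 := by ring
    rw [e, hu2, ← sq_abs δ]
    ring
  have hB1' : ∀ x : PhaseSpace N, 1 - C₃' * u ^ 2 * (1 + W x) ^ m * exp (a * W x) ≤ exp (φ δ x) := by
    intro x
    have hnn : 0 ≤ u ^ 2 * (1 + W x) ^ m * exp (a * W x) := by have := hW0 x; positivity
    have hx := hB1δ x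
    rw [← hu2] at hx
    nlinarith [mul_le_mul_of_nonneg_right hC₃le hnn]
  have hmain := klDiv_flip_tilted_le_window μ₀ hinv hWm hW0 hWflip (hφm δ) hZδ.1 hZδ.2 hθ ha hupos
    hC₃' hT1δ.1 hT1δ.2 hT2δ hB1' hB2δ.1 hB2δ.2 h1.le
  refine hmain.trans (ENNReal.ofReal_le_ofReal ?_)
  rw [hu6]
  have e : (1 / 2) * (1 + 2 * (C₃' * M' * u)) * (D' * δ ^ 2) + C₂ * M * C₁ * (|δ| * δ ^ 2)
      = (D' / 2 + C₃' * M' * u * D' + C₂ * M * C₁ * |δ|) * δ ^ 2 := by ring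
  rw [e]
  exact mul_le_mul_of_nonneg_right (by linarith [h2, h3]) (sq_nonneg δ)

end Seam

end Summit.AtomisticToContinuum.FouriersLaw.Theorems.ExtensiveSnapshotIrreversibility.EnergyWindow

end
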